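import Literature.Geometry.Lorentzian.KerrIngoingCoordConnection
import HarnessLib

/-!
# The Kerr metric in ingoing Kerr coordinates: the lowered curvature tensor from the Koszul form

Infrastructure (all results proved, no definitions) for the curvature invariants of the Kerr metric
(Kretschmann scalar and cubic Weyl invariant; stubs F3/F4 of crux `TameCensorship`,
`KerrKretschmannScalar.lean`). For the rational component field `Kerr.Ingoing.bilin M a` on the
regular set `{Σ ≠ 0, μ² ≠ 1}` and ARBITRARY constant vectors `X, Y, Z, W ∈ E4` (not only coordinate
vectors — this is what makes adapted frames usable), the lowered curvature tensor
`g(R(X,Y)Z, W)` is expressed through the closed-form Koszul form `K` (`Kerr.Ingoing.koszulForm_bilin`),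
its closed-form derivatives `∂_r K`, `∂_μ K` (`Kerr.Ingoing.dKoszulR/M`,
`Kerr.Ingoing.fderiv_koszulForm_bilin`) and the inverse metric `Kerr.Ingoing.ginvMat`:

  `g(R(X,Y)Z, W) = ½ (∂_X K(Y,Z,W) − ∂_Y K(X,Z,W)) − ¼ g^{dc} K(X,W,∂_c) K(Y,Z,∂_d) + ¼ g^{dc} K(Y,W,∂_c) K(X,Z,∂_d)`

(O'Neill 1983, Ch. 3, Lemma 3.38 in first-kind form, `MetricCoord.IsMetricOn.apply_riemAt`, with
`g(Γ(Y,Z), Γ(X,W)) = ¼ g^{dc} K(X,W,∂_c) K(Y,Z,∂_d)`, `Γ = ½ ♯K`). Every concrete component is then a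
`field_simp; ring` identity in `ℚ(r, μ, M, a)`, exactly as the sixteen Ricci identities of
`KerrIngoingCoordRicci.lean`.

## References

* B. O'Neill, *Semi-Riemannian geometry* (1983), Ch. 3, Prop. 3.13, Lemma 3.38, Prop. 3.36.
* R. P. Kerr, Phys. Rev. Lett. 11 (1963) 237–238; M. Visser, arXiv:0706.0622, (E:K1)–(E:K2).
-/

noncomputable section

set_option maxSynthPendingDepth 3

open Set Function Module
open scoped ContDiff Topology
open Literature.Geometry.Lorentzian.MetricCoord

namespace Literature.Geometry.Lorentzian

namespace Kerr

namespace Ingoing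

variable (M a : ℝ) {u : E4}

/-- **`g(Γ(Y,Z), Γ(X,W))` through the Koszul form**:
`g(Γ(Y,Z), Γ(X,W)) = Σ_{d,c} g^{dc} (½ K(X,W,∂_c)) (½ K(Y,Z,∂_d))` (`Γ = ½ ♯K`,
`MetricCoord.apply_chrAt`, components through `Kerr.Ingoing.apply_eq_sum_ginvMat`).
[cite: ONeill1983, Ch. 3, Prop. 3.13] -/
theorem bilin_chrAt_chrAt_eq_sum (hu : u ∈ regularSet a) (X W Y Z : E4) :
    bilin M a u (chrAt (bilin M a) u Y Z) (chrAt (bilin M a) u X W) =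
      ∑ d, ∑ c, ginvMat M a u d c * (2⁻¹ * koszulCLM (bilin M a) u X W (E4.basisVector c)) *
        (2⁻¹ * koszulCLM (bilin M a) u Y Z (E4.basisVector d)) := by
  have hinv := isInvertible_bilin M a hu
  conv_lhs => rw [eq_sum_basisVector (chrAt (bilin M a) u X W)]
  rw [map_sum]
  refine Finset.sum_congr rfl fun d _ ↦ ?_
  rw [map_smul, smul_eq_mul, apply_chrAt hinv Y Z,
    apply_eq_sum_ginvMat M a hu (chrAt (bilin M a) u X W) d, Finset.sum_mul]
  refine Finset.sum_congr rfl fun c _ ↦ ?_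
  rw [apply_chrAt hinv X W]

/-- **The lowered curvature tensor of the Kerr components through the Koszul form**, for arbitrary
constant vectors `X, Y, Z, W`:
`g(R(X,Y)Z, W) = ½ (∂_X K(Y,Z,W) − ∂_Y K(X,Z,W)) − g(Γ(Y,Z),Γ(X,W)) + g(Γ(X,Z),Γ(Y,W))`
(`MetricCoord.IsMetricOn.apply_riemAt`) with the derivative in closed form
(`fderiv_koszulForm_bilin`: `∂_V K = V¹ ∂_r K + V² ∂_μ K`) and the `ΓΓ` terms through
`bilin_chrAt_chrAt_eq_sum`. Slot convention: `MetricCoord.koszulCLM G y X Y Z = OpensChart.koszulForm G y Y X Z`.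
[cite: ONeill1983, Ch. 3, Lemma 3.38] -/
theorem bilin_riemAt_eq_koszul (hu : u ∈ regularSet a) (X Y Z W : E4) :
    bilin M a u (riemAt (bilin M a) u X Y Z) W =
      2⁻¹ * ((dKoszulR M a u Z Y W * X 1 + dKoszulM M a u Z Y W * X 2) -
          (dKoszulR M a u Z X W * Y 1 + dKoszulM M a u Z X W * Y 2)) -
        ∑ d, ∑ c, ginvMat M a u d c *
          (2⁻¹ * OpensChart.koszulForm (bilin M a) u W X (E4.basisVector c)) *
          (2⁻¹ * OpensChart.koszulForm (bilin M a) u Z Y (E4.basisVector d)) +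
        ∑ d, ∑ c, ginvMat M a u d c *
          (2⁻¹ * OpensChart.koszulForm (bilin M a) u W Y (E4.basisVector c)) *
          (2⁻¹ * OpensChart.koszulForm (bilin M a) u Z X (E4.basisVector d)) := by
  rw [(isMetricOn_bilin M a).apply_riemAt hu X Y Z W, bilin_chrAt_chrAt_eq_sum M a hu X W Y Z,
    bilin_chrAt_chrAt_eq_sum M a hu Y W X Z]
  have h1 : fderiv ℝ (fun y ↦ koszulCLM (bilin M a) y Y Z W) u X =
      dKoszulR M a u Z Y W * X 1 + dKoszulM M a u Z Y W * X 2 :=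
    fderiv_koszulForm_bilin M a hu Z Y W X
  have h2 : fderiv ℝ (fun y ↦ koszulCLM (bilin M a) y X Z W) u Y =
      dKoszulR M a u Z X W * Y 1 + dKoszulM M a u Z X W * Y 2 :=
    fderiv_koszulForm_bilin M a hu Z X W Y
  rw [h1, h2]
  rfl

end Ingoing

end Kerr

end Literature.Geometry.Lorentzian

end
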